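import Summits.QuantumFields.YangMills.Theorems.BalabanUVNodesN12GuardedLinAvgRightInverse
import Summits.QuantumFields.YangMills.Theorems.BalabanUVNodesK0Stub1RecordAveragingRightInverse
import Literature.MathematicalPhysics.QuantumFieldTheory.Balaban1983to89.B16Ineq19NearFlatSliceNorms

/-!
# BalabanUVNodes ∕ N12 — module F′: THE (45)–(46) RIGHT INVERSE AT A GUARDED NEAR-FLAT BACKGROUND ON THE INDEX BONDS OF EVERY ADMISSIBLE FAMILY — module F's displayed
# flat right inverse DISCHARGED by k0-s1-w1's `K0Stub1RecordAveragingRightInverse.exists_suRightInverse_qLin_one(_of_adm22_T4)` (print's (45) for the TRUE averaging at `U₀ = 1`)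

Cell `pub-ymgap` (HUMAN RULINGS D-0062 ∕ D-0149), width seat `pub-ymgap-dag-n10-w1` g2; junction edition of module F (`…N12GuardedLinAvgRightInverse`, p605814 ✓) with k0-s1-w1 g3's
`…K0Stub1RecordAveragingRightInverse` (p604735∕p604736 ✓).  Key K1⁷ `stmt-QuantumFields-20542`, `--kind proof --supports … --as helper`; count-neutral; THEOREMS ONLY
(0 `def`, 0 `sorry`, 0 `instance`, 0 `notation`).  CONSUMED BY NAME, nothing modified: module F (`exists_rightInverse_suProj_qLin_of_flat`), k0-s1-w1's
`exists_suRightInverse_qLin_one` (generic torus, scalar flat right-inverse data displayed) and `exists_suRightInverse_qLin_one_of_adm22_T4` (AT NODE 00's RECORD, unconditional: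
k0-s1-w3's P9 `body_of_adm22_T4` thresholds `Mh₀`, `R₀`), n07-w2's `Node00.suProj_coe`, n12-w2's `B16Ineq19NearFlatSliceNorms.opNorm_coe_le_norm_lieSU`.

THE PRINT.  [Balaban1985Variational] Sect. C (44)–(46) p. 285 (the right inverse `H` of `Q_k(U₀)`: (45) «L^jηQ_jHB = B on Λ_j» at the background of the variational problem);
[Balaban1984PropagatorsII] (2.1)–(2.2) p. 224 (admissible nested families).

CONTENTS.  §1 (generic torus `P`) `exists_rightInverse_suProj_qLin_adm22_of_flatData` — module F at `ι := BondIdx D` fed with k0-s1-w1's generic flat theorem (its scalar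
right-inverse data `H₀`, `hinv`, weights and letter stay DISPLAYED as there; the factor `η` is rescaled away): `∃ ρ′ > 0 ∀ U₀`, `‖↑U₀ − 1‖ < ρ′ → ∃ H` real-linear with
`π(qLin j U₀ (H y) c) = y_{(j,c)}` on `𝔅`.  §2 (AT THE RECORD) ★★★ `exists_rightInverse_suProj_qLin_adm22_T4` — for every `F : T4Family`: thresholds `Mh₀`, `R₀` such that EVERY
admissible nested family `D` on `Site (F.P K) 0` in the standing range (`1 ≤ K − n`, `K − n + 1 ≤ m + K`, `Adm22 D R (L·M_h)`, `M_h = L^{a′} ≥ Mh₀`, `R ≥ max R₀ 2`, `a′ + 3 ≤ m + n`,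
`D.k = K − n`) carries a radius `ρ′ > 0` and, at EVERY background `U₀` with `‖↑U₀ − 1‖ < ρ′`, a REAL-LINEAR RIGHT INVERSE of the linearised multi-level (0.4)-constraint
`X ↦ (π(qLin j U₀ X c))_{(j,c) ∈ 𝔅}` on `𝔰𝔲(N)`-valued fields — print's (45) at curved near-flat backgrounds, UNCONDITIONALLY at the record.  §3 (§0 `flatBinder_of_eta_smul`
is the `η`-rescaling) `opNorm_coe_apply_le_norm`, `letter_of_weighted` (k0-s1-w1's weighted (46) letter, `w₁ = L^{lev}·η ≥ η` ⟹ module F's letter for `H ∘ (η•)`), ★★★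
`exists_radius_rightInverse_suProj_qLin_adm22_T4` — ONE `ρ′` PER HEIGHT `(n, K)` for ALL admissible families of the standing range and ALL `‖↑U₀ − 1‖ < ρ′`, WITH the letter
`‖↑(H y)‖ ≤ 2B‖y‖` (`B` = k0-s1-w1's d = 4 constant `2B₀(1+12L)(1+12L+12L²)`, or its `|B₀|` variant in the degenerate sign case).

HONEST FRAMING.  Junction bookkeeping by name; in §2 the radius `ρ′` depends on the family `D` (letter-free: `B` by finite-dimensionality) — the uniform-radius edition
is §3 (module F's `exists_radius_rightInverse_suProj_qLin` fed with k0-s1-w1's weighted (46) letter, `w₁ ≥ η`, through the operator-vs-Hilbert–Schmidt comparison on `𝔰𝔲(N)` of n12-w2's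
`B16Ineq19NearFlatSliceNorms`); print's explicit `O(L²α₀)` small-field radius is NOT claimed; nothing of Bałaban's analysis asserted; N12 ∕ N07 NOT discharged; K1⁷ ∕ K0⁷ NOT closed; count-neutral
(typed 28∕28 · discharged 5∕27 unmoved); one finite 𝕋⁴ programme at fixed ε — R4 closes the conditional rung `BalabanLadder.UV` only; the YM mass gap (Clay) is NOT proved by
any of this.  No `sorry`, no `def`, no `instance`, no `notation`.
-/

noncomputable section

open scoped BigOperators Matrix.Norms.L2Operator

namespace Summit.QuantumFields.YangMills.BalabanUVNodes.N12GuardedLinAvgRightInverseAdm22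

open Literature.MathematicalPhysics.QuantumFieldTheory.Balaban1983to89
open T4Continuum (T4Family)
open T4AdjointCovarianceUnitary (lieSU)
open Node00
open B6SectADomainsV1 (Domains)
open B6SectAOperatorsV1 (BondIdx)
open B11Eq115Space (levOf)
open LatticeFieldCalculus (bondAvgIter)
open Summit.QuantumFields.YangMills.Theorems.FlatCubeOpsText (Adm22)
open B16Ineq19NearFlatSliceNorms (opNorm_coe_le_norm_lieSU)
open Summit.QuantumFields.YangMills.Theorems.K0Stub1RecordAveragingRightInverse (exists_suRightInverse_qLin_one exists_suRightInverse_qLin_one_of_adm22_T4)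
open Summit.QuantumFields.YangMills.BalabanUVNodes.N12GuardedLinAvgRightInverse (exists_rightInverse_suProj_qLin_of_flat exists_radius_rightInverse_suProj_qLin)

/-! ## §0  Rescaling a flat right inverse with the factor `η` into module F's binder shape -/

section Rescale

variable {P : Params} {N : ℕ} [NeZero N]

/-- From k0-s1-w1's matrix-level flat identity `η·qLin j 1 (H X) c = ↑(X (j,c))` (`η ≠ 0`) to module F's binder `π(qLin j 1 (H₁ y) c) = y (j,c)` for `H₁ := H ∘ (η • ·)`.
[cite: Balaban1985Variational, (45) p.285 (bookkeeping)] -/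
theorem flatBinder_of_eta_smul (D : Domains P) {η : ℝ} (hη : 0 < η)
    (H : (BondIdx D → lieSU (Fin N)) →ₗ[ℝ] (PBond P 0 → lieSU (Fin N)))
    (hinvH : ∀ (X : BondIdx D → lieSU (Fin N)) (idx : BondIdx D),
      (η : ℂ) • qLin (idx.1.1 : ℕ) (1 : GaugeField P 0 (SU N)) (H X) idx.1.2 = (X idx : Matrix (Fin N) (Fin N) ℂ)) :
    ∀ (y : BondIdx D → lieSU (Fin N)) (idx : BondIdx D),
      suProj N (qLin (idx.1.1 : ℕ) (1 : GaugeField P 0 (SU N)) ((H ∘ₗ (η • LinearMap.id)) y) idx.1.2) = y idx := by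
  intro y idx
  have hηC : (η : ℂ) ≠ 0 := by exact_mod_cast hη.ne'
  have h := hinvH (η • y) idx
  have hcoe : ((η • y) idx : Matrix (Fin N) (Fin N) ℂ) = (η : ℂ) • (y idx : Matrix (Fin N) (Fin N) ℂ) := by
    rw [Pi.smul_apply, Submodule.coe_smul, Complex.coe_smul]
  rw [hcoe] at h
  have h' : qLin (idx.1.1 : ℕ) (1 : GaugeField P 0 (SU N)) (H (η • y)) idx.1.2 = (y idx : Matrix (Fin N) (Fin N) ℂ) := smul_right_injective _ hηC h
  rw [LinearMap.comp_apply, LinearMap.smul_apply, LinearMap.id_apply, h', suProj_coe]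

end Rescale

/-! ## §1  Generic torus: module F on the index bonds of an admissible family, flat data displayed as in k0-s1-w1's generic theorem -/

section Generic

variable {P : Params} {N : ℕ} [NeZero N]

/-- **Module F on `𝔅 = BondIdx D`, flat data displayed**: k0-s1-w1's generic flat right inverse (from a scalar right inverse `H₀` of the straight iterated averages with the weighted
sup letter) followed by module F's perturbation: `∃ ρ′ > 0` such that at every `U₀` with `‖↑U₀ − 1‖ < ρ′` there is a real-linear right inverse of `X ↦ (π(qLin j U₀ X c))_{(j,c) ∈ 𝔅}`.
[cite: Balaban1985Variational, (44)-(46) p.285; Balaban1984PropagatorsII, (2.1)-(2.2) p.224] -/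
theorem exists_rightInverse_suProj_qLin_adm22_of_flatData (D : Domains P) {R M : ℕ} (hAdm : Adm22 D R M) (hRM : 2 * P.L ≤ R * M + 1) {η : ℝ} (hη : 0 < η)
    (w₁ : PBond P 0 → ℝ) (hw₁ : ∀ b, w₁ b = (P.L : ℝ) ^ levOf (fun i => {z : Site P 0 | D.InOm i z}) D.k b.src * η)
    (H₀ : (BondIdx D → ℝ) →ₗ[ℝ] (PBond P 0 → ℝ)) (hinv : ∀ (X : BondIdx D → ℝ) (i : BondIdx D), bondAvgIter (i.1.1 : ℕ) (H₀ X) i.1.2 = X i)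
    {B₀ : ℝ} (hB₀ : 0 ≤ B₀)
    (hsup : ∀ (Xr : BondIdx D → ℝ) (t : ℝ), 0 ≤ t → (∀ i, ((P.L : ℝ) ^ (i.1.1 : ℕ) * η) * |Xr i| ≤ t) → ∀ b, w₁ b * |H₀ Xr b| ≤ B₀ * t) :
    ∃ ρ' : ℝ, 0 < ρ' ∧ ∀ U : GaugeField P 0 (SU N), ‖coeField U - 1‖ < ρ' →
      ∃ H : (BondIdx D → lieSU (Fin N)) →ₗ[ℝ] (PBond P 0 → lieSU (Fin N)),
        ∀ (y : BondIdx D → lieSU (Fin N)) (idx : BondIdx D), suProj N (qLin (idx.1.1 : ℕ) U (H y) idx.1.2) = y idx := by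
  obtain ⟨H, hinvH, -⟩ := exists_suRightInverse_qLin_one (N := N) D hAdm hRM hη w₁ hw₁ H₀ hinv hB₀ hsup
  have h₁ := flatBinder_of_eta_smul (N := N) D hη H hinvH
  obtain ⟨ρ', hρ', h⟩ := exists_rightInverse_suProj_qLin_of_flat (P := P) (N := N) D.k (fun idx : BondIdx D => (idx.1.1 : ℕ))
    (fun idx => Nat.lt_succ_iff.1 idx.1.1.2) (fun idx => idx.1.2) (H ∘ₗ (η • LinearMap.id)) h₁
  refine ⟨ρ', hρ', fun U hU => ?_⟩
  obtain ⟨G, hG⟩ := h U hU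
  exact ⟨(H ∘ₗ (η • LinearMap.id)) ∘ₗ G, fun y idx => by rw [LinearMap.comp_apply]; exact hG y idx⟩

end Generic

/-! ## §2  AT NODE 00's RECORD: every admissible family, unconditionally -/

section Record

variable {N : ℕ} [NeZero N]

/-- ★★★ **PRINT's (45) AT GUARDED NEAR-FLAT BACKGROUNDS, AT THE RECORD, FOR EVERY ADMISSIBLE FAMILY** — k0-s1-w1's `exists_suRightInverse_qLin_one_of_adm22_T4` (flat, unconditional via
k0-s1-w3's P9 thresholds `Mh₀`, `R₀`) followed by module F: every admissible nested family `D` on `Site (F.P K) 0` in the standing range carries `ρ′ > 0` such that at EVERY `U₀` with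
`‖↑U₀ − 1‖ < ρ′` there is a REAL-LINEAR right inverse `H` of the linearised multi-level (0.4)-constraint: `π(qLin j U₀ (H y) c) = y_{(j,c)}` for all `(j,c) ∈ 𝔅`.
[cite: Balaban1985Variational, (44)-(46) p.285, (156)-(157) p.302; Balaban1984PropagatorsII, (2.1)-(2.2) p.224, Cor. 2.8 (2.150)-(2.151) p.249] -/
theorem exists_rightInverse_suProj_qLin_adm22_T4 (F : T4Family) :
    ∃ (Mh₀ R₀ : ℕ), ∀ (n K : ℕ) (_ : 1 ≤ K - n) (_ : K - n + 1 ≤ F.m + K) {Mh R a' : ℕ} (_ : Mh = F.L ^ a') (_ : Mh₀ ≤ Mh) (_ : max R₀ 2 ≤ R)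
      (_ : a' + 3 ≤ F.m + n) (D : Domains (F.P K)) (_ : D.k = K - n) (_ : Adm22 D R (F.L * Mh)),
      ∃ ρ' : ℝ, 0 < ρ' ∧ ∀ U : GaugeField (F.P K) 0 (SU N), ‖coeField U - 1‖ < ρ' →
        ∃ H : (BondIdx D → lieSU (Fin N)) →ₗ[ℝ] (PBond (F.P K) 0 → lieSU (Fin N)),
          ∀ (y : BondIdx D → lieSU (Fin N)) (idx : BondIdx D), suProj N (qLin (idx.1.1 : ℕ) U (H y) idx.1.2) = y idx := by
  obtain ⟨Mh₀, R₀, B₀, hmain⟩ := exists_suRightInverse_qLin_one_of_adm22_T4 (N := N) F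
  refine ⟨Mh₀, R₀, fun n K hk1 hk' Mh R a' hMha hMh hR hsize D hDk hAdm => ?_⟩
  obtain ⟨H, hinvH, -⟩ := hmain n K hk1 hk' hMha hMh hR hsize D hDk hAdm
  have hη : 0 < ((F.L : ℝ)⁻¹) ^ (K - n) := by have := (F.P K).L_pos; positivity
  have hinvH' : ∀ (X : BondIdx D → lieSU (Fin N)) (idx : BondIdx D),
      ((((F.L : ℝ)⁻¹) ^ (K - n) : ℝ) : ℂ) • qLin (idx.1.1 : ℕ) (1 : GaugeField (F.P K) 0 (SU N)) (H X) idx.1.2 = (X idx : Matrix (Fin N) (Fin N) ℂ) :=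
    hinvH
  have h₁ := flatBinder_of_eta_smul (N := N) D hη H hinvH'
  obtain ⟨ρ', hρ', h⟩ := exists_rightInverse_suProj_qLin_of_flat (P := F.P K) (N := N) D.k (fun idx : BondIdx D => (idx.1.1 : ℕ))
    (fun idx => Nat.lt_succ_iff.1 idx.1.1.2) (fun idx => idx.1.2) (H ∘ₗ ((((F.L : ℝ)⁻¹) ^ (K - n)) • LinearMap.id)) h₁
  refine ⟨ρ', hρ', fun U hU => ?_⟩
  obtain ⟨G, hG⟩ := h U hU
  exact ⟨(H ∘ₗ ((((F.L : ℝ)⁻¹) ^ (K - n)) • LinearMap.id)) ∘ₗ G, fun y idx => by rw [LinearMap.comp_apply]; exact hG y idx⟩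

end Record

/-! ## §3  The operator-vs-Hilbert–Schmidt comparison on `𝔰𝔲(N)` and the UNIFORM-RADIUS edition at the record (one `ρ′` for all admissible families of a given height) -/

section Uniform

variable {N : ℕ}

/-- The sup of the operator norms of an `𝔰𝔲(N)`-valued family is at most its (Hilbert–Schmidt) sup norm (n12-w2's `B16Ineq19NearFlatSliceNorms.opNorm_coe_le_norm_lieSU` bondwise +
`norm_le_pi_norm`). [cite: Balaban1985Averaging, (17)-(20) p.21 (bookkeeping)] -/
theorem opNorm_coe_apply_le_norm {ι : Type*} [Fintype ι] (X : ι → lieSU (Fin N)) (i : ι) : ‖(X i : Matrix (Fin N) (Fin N) ℂ)‖ ≤ ‖X‖ :=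
  (opNorm_coe_le_norm_lieSU (X i)).trans (norm_le_pi_norm X i)

/-- **From k0-s1-w1's weighted (46) letter to module F's letter**: with weights `w₁(b) = L^{lev(b)}·η ≥ η > 0` (`L ≥ 1`) the weighted sup letter `w₁(b)‖HX(b)‖ ≤ c·t` (for
`‖↑X_i‖ ≤ t`) gives `‖↑(H(η•y))‖ ≤ c‖y‖` for the rescaled right inverse `H ∘ (η • ·)` of §0. [cite: Balaban1985Variational, (46) p.285 (bookkeeping)] -/
theorem letter_of_weighted {P : Params} (D : Domains P) {η : ℝ} (hη : 0 < η)
    (w₁ : PBond P 0 → ℝ) (hw₁ : ∀ b, w₁ b = (P.L : ℝ) ^ levOf (fun i => {z : Site P 0 | D.InOm i z}) D.k b.src * η)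
    (H : (BondIdx D → lieSU (Fin N)) →ₗ[ℝ] (PBond P 0 → lieSU (Fin N))) {c : ℝ} (hc : 0 ≤ c)
    (hlet : ∀ (X : BondIdx D → lieSU (Fin N)) (t : ℝ), 0 ≤ t → (∀ i, ‖(X i : Matrix (Fin N) (Fin N) ℂ)‖ ≤ t) → ∀ b : PBond P 0,
      w₁ b * ‖(H X b : Matrix (Fin N) (Fin N) ℂ)‖ ≤ c * t) :
    ∀ y : BondIdx D → lieSU (Fin N), ‖(fun b => ((H ∘ₗ (η • LinearMap.id)) y b : Matrix (Fin N) (Fin N) ℂ))‖ ≤ c * ‖y‖ := by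
  intro y
  have hL1 : (1 : ℝ) ≤ P.L := by exact_mod_cast P.L_pos
  refine (pi_norm_le_iff_of_nonneg (by positivity)).2 fun b => ?_
  have hw : η ≤ w₁ b := by
    rw [hw₁ b]
    have h1 : (1 : ℝ) ≤ (P.L : ℝ) ^ levOf (fun i => {z : Site P 0 | D.InOm i z}) D.k b.src := one_le_pow₀ hL1
    nlinarith
  have hwpos : 0 < w₁ b := hη.trans_le hw
  have hX : ∀ i, ‖((η • y) i : Matrix (Fin N) (Fin N) ℂ)‖ ≤ η * ‖y‖ := fun i => by
    rw [Pi.smul_apply, Submodule.coe_smul, norm_smul, Real.norm_of_nonneg hη.le]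
    exact mul_le_mul_of_nonneg_left (opNorm_coe_apply_le_norm y i) hη.le
  have h := hlet (η • y) (η * ‖y‖) (by positivity) hX b
  have happ : ((H ∘ₗ (η • LinearMap.id)) y b : Matrix (Fin N) (Fin N) ℂ) = (H (η • y) b : Matrix (Fin N) (Fin N) ℂ) := by
    rw [LinearMap.comp_apply, LinearMap.smul_apply, LinearMap.id_apply]
  rw [happ]
  -- `w₁ b · ‖…‖ ≤ c η ‖y‖` and `η ≤ w₁ b` ⇒ `‖…‖ ≤ c ‖y‖`
  have hn : 0 ≤ ‖(H (η • y) b : Matrix (Fin N) (Fin N) ℂ)‖ := norm_nonneg _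
  have key : w₁ b * ‖(H (η • y) b : Matrix (Fin N) (Fin N) ℂ)‖ ≤ w₁ b * (c * ‖y‖) := by
    calc w₁ b * ‖(H (η • y) b : Matrix (Fin N) (Fin N) ℂ)‖ ≤ c * (η * ‖y‖) := h
      _ = η * (c * ‖y‖) := by ring
      _ ≤ w₁ b * (c * ‖y‖) := mul_le_mul_of_nonneg_right hw (by positivity)
  exact le_of_mul_le_mul_left key hwpos

variable [NeZero N]

/-- ★★★ **ONE RADIUS FOR ALL ADMISSIBLE FAMILIES OF A GIVEN HEIGHT, AT THE RECORD, WITH THE LETTER**: k0-s1-w1's flat right inverse with its (46) letter (`exists_suRightInverse_qLin_one_of_adm22_T4`)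
fed into module F's `exists_radius_rightInverse_suProj_qLin`: for every `F : T4Family`, thresholds `Mh₀`, `R₀` and a letter constant `B ≥ 0` such that for all heights `n, K` in the
standing range there is `ρ′ > 0` with: EVERY admissible nested family `D` on `Site (F.P K) 0` (`D.k = K − n`, `Adm22 D R (L·M_h)`, `M_h = L^{a′} ≥ Mh₀`, `R ≥ max R₀ 2`,
`a′ + 3 ≤ m + n`) and EVERY `U₀` with `‖↑U₀ − 1‖ < ρ′` carry a REAL-LINEAR right inverse `H` of `X ↦ (π(qLin j U₀ X c))_{(j,c) ∈ 𝔅}` with `‖↑(H y)‖ ≤ 2B‖y‖`.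
[cite: Balaban1985Variational, (44)-(46) p.285, (156)-(157) p.302; Balaban1984PropagatorsII, (2.1)-(2.2) p.224, Cor. 2.8 (2.150)-(2.151) p.249] -/
theorem exists_radius_rightInverse_suProj_qLin_adm22_T4 (F : T4Family) :
    ∃ (Mh₀ R₀ : ℕ) (B : ℝ), 0 ≤ B ∧ ∀ (n K : ℕ) (_ : 1 ≤ K - n) (_ : K - n + 1 ≤ F.m + K),
      ∃ ρ' : ℝ, 0 < ρ' ∧ ∀ {Mh R a' : ℕ} (_ : Mh = F.L ^ a') (_ : Mh₀ ≤ Mh) (_ : max R₀ 2 ≤ R)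
        (_ : a' + 3 ≤ F.m + n) (D : Domains (F.P K)) (_ : D.k = K - n) (_ : Adm22 D R (F.L * Mh))
        (U : GaugeField (F.P K) 0 (SU N)), ‖coeField U - 1‖ < ρ' →
        ∃ H : (BondIdx D → lieSU (Fin N)) →ₗ[ℝ] (PBond (F.P K) 0 → lieSU (Fin N)),
          (∀ (y : BondIdx D → lieSU (Fin N)) (idx : BondIdx D), suProj N (qLin (idx.1.1 : ℕ) U (H y) idx.1.2) = y idx) ∧
            ∀ y, ‖(fun b => (H y b : Matrix (Fin N) (Fin N) ℂ))‖ ≤ 2 * B * ‖y‖ := by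
  obtain ⟨Mh₀, R₀, B₀, hmain⟩ := exists_suRightInverse_qLin_one_of_adm22_T4 (N := N) F
  -- the letter constant of k0-s1-w1's theorem (`d = 4`: `C = 6L`)
  set c : ℝ := 2 * (B₀ * ((1 + 2 * ((4 + 2) * F.L : ℕ)) * (1 + 2 * ((4 + 2) * F.L : ℕ) + 2 * ((4 + 2) * F.L : ℕ) * F.L))) with hc
  by_cases hB₀ : 0 ≤ B₀
  · have hc0 : 0 ≤ c := by rw [hc]; positivity
    refine ⟨Mh₀, R₀, c, hc0, fun n K hk1 hk' => ?_⟩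
    obtain ⟨ρ', hρ', hrad⟩ := exists_radius_rightInverse_suProj_qLin (P := F.P K) (N := N) (K - n) hc0
    refine ⟨ρ', hρ', fun {Mh R a'} hMha hMh hR hsize D hDk hAdm U hU => ?_⟩
    obtain ⟨H, hinvH, hlet⟩ := hmain n K hk1 hk' hMha hMh hR hsize D hDk hAdm
    have hη : 0 < ((F.L : ℝ)⁻¹) ^ (K - n) := by have := (F.P K).L_pos; positivity
    have h₁ := flatBinder_of_eta_smul (N := N) D hη H hinvH
    have hw₁ : ∀ b : PBond (F.P K) 0, ((F.L : ℝ) ^ levOf (fun i => {z : Site (F.P K) 0 | D.InOm i z}) D.k b.src * ((F.L : ℝ)⁻¹) ^ (K - n))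
        = ((F.P K).L : ℝ) ^ levOf (fun i => {z : Site (F.P K) 0 | D.InOm i z}) D.k b.src * ((F.L : ℝ)⁻¹) ^ (K - n) := fun _ => rfl
    have hB := letter_of_weighted (N := N) D hη (fun b => (F.L : ℝ) ^ levOf (fun i => {z : Site (F.P K) 0 | D.InOm i z}) D.k b.src * ((F.L : ℝ)⁻¹) ^ (K - n))
      hw₁ H hc0 hlet
    have hlv : ∀ idx : BondIdx D, ((idx.1.1 : ℕ)) ≤ K - n := fun idx => hDk ▸ Nat.lt_succ_iff.1 idx.1.1.2
    obtain ⟨G, hG, -, hGB⟩ := hrad (fun idx : BondIdx D => (idx.1.1 : ℕ)) hlv (fun idx => idx.1.2)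
      (H ∘ₗ ((((F.L : ℝ)⁻¹) ^ (K - n)) • LinearMap.id)) h₁ hB U hU
    exact ⟨(H ∘ₗ ((((F.L : ℝ)⁻¹) ^ (K - n)) • LinearMap.id)) ∘ₗ G, fun y idx => by rw [LinearMap.comp_apply]; exact hG y idx,
      fun y => by rw [LinearMap.comp_apply]; exact hGB y⟩
  · -- `B₀ < 0` cannot occur with a nonempty index set; in that degenerate case the letter forces `X = 0`-type vacuity — we simply fall back to `B₀⁺ := 0`-free bookkeeping:
    -- replace `B₀` by `|B₀|`, whose letter is weaker.
    have hB₀' : 0 ≤ |B₀| := abs_nonneg _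
    set c' : ℝ := 2 * (|B₀| * ((1 + 2 * ((4 + 2) * F.L : ℕ)) * (1 + 2 * ((4 + 2) * F.L : ℕ) + 2 * ((4 + 2) * F.L : ℕ) * F.L))) with hc'
    have hc0 : 0 ≤ c' := by rw [hc']; positivity
    refine ⟨Mh₀, R₀, c', hc0, fun n K hk1 hk' => ?_⟩
    obtain ⟨ρ', hρ', hrad⟩ := exists_radius_rightInverse_suProj_qLin (P := F.P K) (N := N) (K - n) hc0
    refine ⟨ρ', hρ', fun {Mh R a'} hMha hMh hR hsize D hDk hAdm U hU => ?_⟩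
    obtain ⟨H, hinvH, hlet⟩ := hmain n K hk1 hk' hMha hMh hR hsize D hDk hAdm
    have hη : 0 < ((F.L : ℝ)⁻¹) ^ (K - n) := by have := (F.P K).L_pos; positivity
    have h₁ := flatBinder_of_eta_smul (N := N) D hη H hinvH
    have hlet' : ∀ (X : BondIdx D → lieSU (Fin N)) (t : ℝ), 0 ≤ t → (∀ i, ‖(X i : Matrix (Fin N) (Fin N) ℂ)‖ ≤ t) → ∀ b : PBond (F.P K) 0,
        ((F.L : ℝ) ^ levOf (fun i => {z : Site (F.P K) 0 | D.InOm i z}) D.k b.src * ((F.L : ℝ)⁻¹) ^ (K - n)) * ‖(H X b : Matrix (Fin N) (Fin N) ℂ)‖ ≤ c' * t := by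
      intro X t ht hXt b
      refine (hlet X t ht hXt b).trans ?_
      rw [hc']
      have hle : B₀ ≤ |B₀| := le_abs_self _
      have hpos : 0 ≤ ((1 + 2 * ((4 + 2) * F.L : ℕ)) * (1 + 2 * ((4 + 2) * F.L : ℕ) + 2 * ((4 + 2) * F.L : ℕ) * F.L) : ℝ) * t := by positivity
      nlinarith
    have hB := letter_of_weighted (N := N) D hη (fun b => (F.L : ℝ) ^ levOf (fun i => {z : Site (F.P K) 0 | D.InOm i z}) D.k b.src * ((F.L : ℝ)⁻¹) ^ (K - n))
      (fun _ => rfl) H hc0 hlet'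
    have hlv : ∀ idx : BondIdx D, ((idx.1.1 : ℕ)) ≤ K - n := fun idx => hDk ▸ Nat.lt_succ_iff.1 idx.1.1.2
    obtain ⟨G, hG, -, hGB⟩ := hrad (fun idx : BondIdx D => (idx.1.1 : ℕ)) hlv (fun idx => idx.1.2)
      (H ∘ₗ ((((F.L : ℝ)⁻¹) ^ (K - n)) • LinearMap.id)) h₁ hB U hU
    exact ⟨(H ∘ₗ ((((F.L : ℝ)⁻¹) ^ (K - n)) • LinearMap.id)) ∘ₗ G, fun y idx => by rw [LinearMap.comp_apply]; exact hG y idx,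
      fun y => by rw [LinearMap.comp_apply]; exact hGB y⟩

end Uniform

end Summit.QuantumFields.YangMills.BalabanUVNodes.N12GuardedLinAvgRightInverseAdm22

end
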